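/-
Origin: expansion seat `prover-pub-hodgecm-mc-sinst-1-g9-0`, handover #1245 2026-08-20T21:51Z md5 cd5f590b1a4b (223 l.; NEW additive leaf, ns HodgeCM.Model / HodgeCM.Model.ProductKTypeFamilies; imports PKG Model/SupplySituation + PKG #1238 Model/AdelicThetaModuleFin only (DROP-ALONE); certified privately rc 0 / 8 s, 0 warn / 0 proof-hole against RUN-63 PKG oleans, `#print axioms` 11/11 ⊆ {propext, Classical.choice, Quot.sound} (out/logs/AxFam.log), 0 records / 0 `def … : Prop`, FQN grep vs PKG 0; CONTENT = the container of the (J4) theta DISTRIBUTION: structure **`ProductKTypeFamilies X k`** (= `ProductKTypeData X k N` of Model/SupplySituation WITHOUT the φ_N anchor `ℓ₀`/`fam₀` and with a SET `𝓐` of linear archimedean families `W^∨ →ₗ 𝒮(𝔸_K^J)` in place of one: fields Γ₀ K₂ κ₂ comm level sat 𝓐 fix arch), `kappa`/`tau`/`sigma` (+ `_apply`, `tau_dual_apply`), `famTop k Φ` (a family read on ThetaTop, `famTop_apply` rfl), `act_family`, `isThetaEquivariant_family`, `isLevelCorrected`, `isWeightMatched`, `families` (+ `mem_families`), **`situation :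 KTypeSituation (X.P k) (X.ιinf Γ₀) (X.Δ Γ₀) X.κ₁ X.τ₁`** (`situation_𝓙` rfl), **`situation_isSaturated`** (at `X.KΓ Γ₀`), **`situation_isStrict`**, **`thetaFormOf B hΦ f : weightForms (X.P k).ΓU B.kappa B.tau`** (tree `ThetaKernelDatum.thetaForm` of the family), `apply_thetaFormOf`, `thetaFormOf_mem_thetaForms`, **`coe_thetaFormOf_mem_adelicThetaSpanSat`** (∈ `adelicThetaSpanSat (X.P k) (X.ιinf Γ₀) X.κ₁ X.τ₁ (X.KΓ Γ₀) 𝓕`, #1238), `coe_thetaFormOf_mem_adelicThetaSpan`; NAMES for audit: `HodgeCM.Model.ProductKTypeFamilies.situation_isStrict` · `HodgeCM.Model.ProductKTypeFamilies.situation_isSaturated` · `HodgeCM.Model.ProductKTypeFamilies.coe_thetaFormOf_mem_adelicThetaSpanSat`) (`HOME/mc/pub-hodgecm-mc-sinst-1-g9/stage64/HodgeCM/Model/AdelicThetaFamilies.lean`, md5 cd5f590b1a4b, 223 lines);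
landed by the second packager p2 gen 14 (p2-g14) in gate run 64 as `HodgeCM/Model/AdelicThetaFamilies.lean` (verbatim).
-/
/-
Copyright (c) 2026 the pub-hodgecm formalisation cell (harness21).  New file, not vendored.
Origin: session prover-pub-hodgecm-mc-sinst-1-g9-0 (unit pub-hodgecm-mc-sinst-1-g9, S-INSTANCE CONSTRUCTOR gen 9; the (J4) side of the
(J-Liu-Θ) junction behind E's row 9 `hΘ`: the container of the theta DISTRIBUTION — product `K`-type situations carrying a whole SET of
archimedean families `ℓ ↦ Φ_∞(ℓ) ⊗ Φ_f`), 2026-08-20.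
Intended final place: `HodgeCM/Model/AdelicThetaFamilies.lean` (NEW additive model-layer leaf; imports PKG `HodgeCM.Model.SupplySituation` and
sinst-1's `HodgeCM.Model.AdelicThetaModuleFin` (#1238); nothing imports it; drop alone).
-/
import Summits.HodgeConjecture.HodgeCM.Model.SupplySituation
import Summits.HodgeConjecture.HodgeCM.Model.AdelicThetaModuleFin_2

set_option autoImplicit false

/-!
# Product `K`-type situations with many test families; their theta forms in the saturated adèlic theta module

`Model/SupplySituation` builds, from `ProductKTypeData X k N` (ONE archimedean family through `φ_N`), a strict saturated `K`-type
situation.  The theta distribution `Φ_f ↦ θ(Φ_∞ ⊗ Φ_f, f)` of the (J4) input needs the same construction for a whole SET `𝓐` of linear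
archimedean families at once (all `ℓ ↦ Φ_∞(ℓ) ⊗ Φ_f` with `Φ_f` fixed by the finite `K`-type), WITHOUT the anchor `Φfam ℓ₀ = φ_N`:
* `ProductKTypeFamilies X k` — level `Γ₀`, finite `K`-type `K₂ →* G_U(𝔸)` (`comm`, `level`, `sat` as in `ProductKTypeData`), a set `𝓐` of
  linear families `W^∨ →ₗ 𝒮(𝔸_K^J)`, each fixed by the finite `K`-type ((W-Kf) `fix`) and `K₁`-equivariant of type `τ₁^∨` ((W-K∞) `arch`);
* `ProductKTypeFamilies.situation` — the `K`-type situation `Kc := K₁ × K₂`, `E := W^∨`, `𝓙 := {Φ read on ThetaTop | Φ ∈ 𝓐}`; STRICT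
  (`situation_isStrict`) and SATURATED at `K_{Γ₀}` (`situation_isSaturated`) — kernel copies of the one-family proofs;
* `thetaFormOf B Φ hΦ f` — the adelic theta form of the family `Φ ∈ 𝓐` against the weight function `f`; it lies in the situation's
  `thetaForms 𝓕` (`thetaFormOf_mem_thetaForms`, `f ∈ 𝓕`) and hence, as a function on `G_U(𝔸)`, in the SATURATED adèlic theta module
  `adelicThetaSpanSat (X.P k) (X.ιinf Γ₀) X.κ₁ X.τ₁ (X.KΓ Γ₀) 𝓕` of #1238 (`coe_thetaFormOf_mem_adelicThetaSpanSat`); its defining property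
  `apply_thetaFormOf` (`ℓ (θ g) = Θ̃_{Φ ℓ}(f)(g)`).
KERNEL only: 0 records, 0 `def … : Prop`, nothing cited; `#print axioms` ⊆ {propext, Classical.choice, Quot.sound}.
-/

noncomputable section

open MeasureTheory
open Literature.NumberTheory.Automorphic Literature.NumberTheory.Weil1964
open Literature.NumberTheory.Automorphic.WeightForms (ClassMapDatum thetaClasses restrictHom IsLevelCorrected
  IsWeightMatched)
open Literature.AlgebraicGeometry.HodgeTheory
open Literature.NumberTheory.Automorphic.PicardCM
open HodgeCM.PerL34.Seesaw HodgeCM.PerL34.RationalCoset HodgeCM.PerL34.SupplyAdelic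
open HodgeCM.Model.SupplyInstance HodgeCM.Model.SupplyResidual
open HodgeCM.Model.SupplyResidual.WeilPairData (charInv)
open HodgeCM.Model.ThetaSpace
open scoped Classical

namespace HodgeCM
namespace Model

variable {U : Universe} {Lc : CMField} {ι₁ : Lc →+* ℂ} {V : HermSpace3 Lc ι₁} {c : SeesawCtx Lc}

/-! ### § 1. The data -/

/-- **Product `K`-type data with a SET of archimedean families** for the input `X`, type index `k`: the level `Γ₀`, the finite part
`K₂ → G_U(𝔸)` of the `K`-type (commuting with the archimedean component, absorbing the level, saturating `K_{Γ₀}`), and a set `𝓐` of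
linear archimedean families of test functions, each fixed by `K₂` and `K₁`-equivariant of type `τ₁^∨` under the pair's Weil action. -/
structure ProductKTypeFamilies (X : ThetaSpaceInput U V c) (k : Fin 4) : Type 1 where
  /-- the level at which the forms are produced -/
  Γ₀ : Level V
  /-- the finite part `K_f` of the `K`-type -/
  K₂ : Type
  [instK₂ : Group K₂]
  /-- its map to `G_U(𝔸)` -/
  κ₂ : K₂ →* X.GU
  /-- it commutes with the archimedean component -/
  comm : ∀ (m : K₂) (x : X.G₁), Commute (κ₂ m) (X.ιinf Γ₀ x)
  /-- it absorbs the level -/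
  level : ∀ δ ∈ X.Δ Γ₀, ∃ m : K₂, X.ιinf Γ₀ δ * κ₂ m ∈ (X.P k).ΓU
  /-- saturation: every element of `K_{Γ₀}`, placed in `G_U(𝔸)`, is an index element -/
  sat : ∀ g ∈ X.KΓ Γ₀, ∃ m : K₂, κ₂ m = g
  /-- the archimedean families `ℓ ↦ Φ_∞(ℓ) ⊗ Φ_f` -/
  𝓐 : Set (Module.Dual ℂ X.W →ₗ[ℂ] piSchwartzBruhat X.K X.J)
  /-- (W-Kf) the finite part of the `K`-type fixes every family -/
  fix : ∀ Φ ∈ 𝓐, ∀ (m : K₂) (ℓ : Module.Dual ℂ X.W), (X.P k).ω (κ₂ m, 1) (Φ ℓ) = Φ ℓ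
  /-- (W-K∞) every family is `K₁`-equivariant of type `τ₁^∨` -/
  arch : ∀ Φ ∈ 𝓐, ∀ (u : X.K₁) (ℓ : Module.Dual ℂ X.W),
    (X.P k).ω (X.ιinf Γ₀ (X.κ₁ u), 1) (Φ ℓ) = Φ (X.τ₁.dual u ℓ)

attribute [instance] ProductKTypeFamilies.instK₂

namespace ProductKTypeFamilies

variable {X : ThetaSpaceInput U V c} {k : Fin 4} (B : ProductKTypeFamilies X k)

/-- The `K`-type map `κ (u, m) := ιinf (κ₁ u) · κ₂ m`. -/
def kappa : X.K₁ × B.K₂ →* X.GU :=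
  ((X.ιinf B.Γ₀).comp X.κ₁).noncommCoprod B.κ₂ fun u m => (B.comm m (X.κ₁ u)).symm

/-- (Ported verbatim from the HodgeCMPerL package; no docstring in the source.) -/
@[simp] theorem kappa_apply (u : X.K₁) (m : B.K₂) : B.kappa (u, m) = X.ιinf B.Γ₀ (X.κ₁ u) * B.κ₂ m := rfl

/-- The weight `τ := τ₁ ∘ fst`. -/
def tau : Representation ℂ (X.K₁ × B.K₂) X.W := X.τ₁.comp (MonoidHom.fst X.K₁ B.K₂)

/-- (Ported verbatim from the HodgeCMPerL package; no docstring in the source.) -/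
@[simp] theorem tau_apply (u : X.K₁) (m : B.K₂) : B.tau (u, m) = X.τ₁ u := rfl

/-- The `K`-type `σ := τ₁^∨ ∘ fst` on `E := W^∨`. -/
def sigma : Representation ℂ (X.K₁ × B.K₂) (Module.Dual ℂ X.W) := X.τ₁.dual.comp (MonoidHom.fst X.K₁ B.K₂)

/-- (Ported verbatim from the HodgeCMPerL package; no docstring in the source.) -/
@[simp] theorem sigma_apply (u : X.K₁) (m : B.K₂) : B.sigma (u, m) = X.τ₁.dual u := rfl

/-- (Ported verbatim from the HodgeCMPerL package; no docstring in the source.) -/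
theorem tau_dual_apply (x : X.K₁ × B.K₂) (ℓ : Module.Dual ℂ X.W) : B.tau.dual x ℓ = B.sigma x ℓ := by
  obtain ⟨u, m⟩ := x
  simp [Representation.dual_apply, tau, sigma]

/-- A family, read on the `Θ`-initial carrier of the slot `k`. -/
def famTop (k : Fin 4) (Φ : Module.Dual ℂ X.W →ₗ[ℂ] piSchwartzBruhat X.K X.J) :
    Module.Dual ℂ X.W →ₗ[ℂ] (X.P k).weilDatum.ThetaTop := Φ

/-- (Ported verbatim from the HodgeCMPerL package; no docstring in the source.) -/
theorem famTop_apply (Φ : Module.Dual ℂ X.W →ₗ[ℂ] piSchwartzBruhat X.K X.J) (ℓ : Module.Dual ℂ X.W) :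
    famTop k Φ ℓ = (X.P k).weilDatum.toThetaTop (Φ ℓ) := rfl

/-- (W-Kf) + (W-K∞) ⇒ a family of `𝓐` intertwines `σ` with the Weil ACTION `s(κ ·, 1)` on the nose. -/
theorem act_family {Φ : Module.Dual ℂ X.W →ₗ[ℂ] piSchwartzBruhat X.K X.J} (hΦ : Φ ∈ B.𝓐) (x : X.K₁ × B.K₂)
    (ℓ : Module.Dual ℂ X.W) :
    famTop k Φ (B.sigma x ℓ) = (X.P k).kernelDatum.W.act ((X.P k).kernelDatum.s (B.kappa x, 1)) (famTop k Φ ℓ) := by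
  obtain ⟨u, m⟩ := x
  change Φ (X.τ₁.dual u ℓ) = (X.P k).ω (X.ιinf B.Γ₀ (X.κ₁ u) * B.κ₂ m, 1) (Φ ℓ)
  have hmul : ((X.ιinf B.Γ₀ (X.κ₁ u) * B.κ₂ m, 1) : X.GU × relNormOneIdeles X.K X.L) =
      (X.ιinf B.Γ₀ (X.κ₁ u), 1) * (B.κ₂ m, 1) := by
    simp [Prod.mk_mul_mk]
  rw [hmul, map_mul, Module.End.mul_apply, B.fix Φ hΦ, B.arch Φ hΦ]

/-- (W-Kf) + (W-K∞) ⇒ theta-equivariance of every family of `𝓐`. -/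
theorem isThetaEquivariant_family {Φ : Module.Dual ℂ X.W →ₗ[ℂ] piSchwartzBruhat X.K X.J} (hΦ : Φ ∈ B.𝓐) :
    (X.P k).kernelDatum.IsThetaEquivariant B.kappa B.sigma (famTop k Φ) :=
  (X.P k).kernelDatum.isThetaEquivariant_of_act (B.act_family hΦ)

/-- Level correction of the product `K`-type. -/
theorem isLevelCorrected : IsLevelCorrected (X.P k).ΓU B.kappa B.tau (X.ιinf B.Γ₀) (X.Δ B.Γ₀) := by
  intro δ hδ
  obtain ⟨m, hm⟩ := B.level δ hδ
  refine ⟨(1, m), by simp, by simpa using hm, fun x => ?_⟩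
  simpa using B.comm m x

/-- Weight matching of the product `K`-type (`η₁ := inl`). -/
theorem isWeightMatched : IsWeightMatched B.kappa B.tau (X.ιinf B.Γ₀) X.κ₁ X.τ₁ (MonoidHom.inl X.K₁ B.K₂) :=
  ⟨fun u => by simp, fun _ => rfl⟩

/-- The test families of the situation: the families of `𝓐` read on `ThetaTop`, with their equivariance. -/
def families : Set {j : Module.Dual ℂ X.W →ₗ[ℂ] (X.P k).weilDatum.ThetaTop //
    (X.P k).kernelDatum.IsThetaEquivariant B.kappa B.sigma j} :=
  {j | ∃ (Φ : Module.Dual ℂ X.W →ₗ[ℂ] piSchwartzBruhat X.K X.J), Φ ∈ B.𝓐 ∧ j.1 = famTop k Φ}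

/-- (Ported verbatim from the HodgeCMPerL package; no docstring in the source.) -/
theorem mem_families {Φ : Module.Dual ℂ X.W →ₗ[ℂ] piSchwartzBruhat X.K X.J} (hΦ : Φ ∈ B.𝓐) :
    (⟨famTop k Φ, B.isThetaEquivariant_family hΦ⟩ : {j : Module.Dual ℂ X.W →ₗ[ℂ] (X.P k).weilDatum.ThetaTop //
      (X.P k).kernelDatum.IsThetaEquivariant B.kappa B.sigma j}) ∈ B.families :=
  ⟨Φ, hΦ, rfl⟩

/-! ### § 2. The situation -/

/-- **The `K`-type situation of the families `𝓐`.** -/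
def situation : KTypeSituation (X.P k) (X.ιinf B.Γ₀) (X.Δ B.Γ₀) X.κ₁ X.τ₁ where
  Kc := X.K₁ × B.K₂
  κ := B.kappa
  E := Module.Dual ℂ X.W
  σ := B.sigma
  τ := B.tau
  ι := LinearMap.id
  hι := B.tau_dual_apply
  η₁ := MonoidHom.inl X.K₁ B.K₂
  hΔ := B.isLevelCorrected
  hη := B.isWeightMatched
  𝓙 := B.families

/-- (Ported verbatim from the HodgeCMPerL package; no docstring in the source.) -/
@[simp] theorem situation_𝓙 : B.situation.𝓙 = B.families := rfl

/-- The situation is SATURATED at `K_{Γ₀}`: index `(1, m)`, weight `τ₁ 1 = 1`. -/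
theorem situation_isSaturated : B.situation.IsSaturated (X.KΓ B.Γ₀) := fun g hg => by
  obtain ⟨m, hm⟩ := B.sat g hg
  refine ⟨(1, m), ?_, ?_⟩
  · change B.kappa (1, m) = g
    rw [kappa_apply, map_one, map_one, one_mul, hm]
  · change B.tau (1, m) = 1
    rw [tau_apply, map_one]

/-- The situation is STRICT: every family acts on the nose (`act_family`). -/
theorem situation_isStrict : B.situation.IsStrict := by
  rintro j ⟨Φ, hΦ, hj⟩ x e
  change j.1 (B.sigma x e) = (X.P k).kernelDatum.W.act ((X.P k).kernelDatum.s (B.kappa x, 1)) (j.1 e)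
  rw [hj]
  exact B.act_family hΦ x e

/-! ### § 3. The theta forms of the families -/

/-- **The adelic theta form of the family `Φ ∈ 𝓐` against the weight function `f`.** -/
def thetaFormOf {Φ : Module.Dual ℂ X.W →ₗ[ℂ] piSchwartzBruhat X.K X.J} (hΦ : Φ ∈ B.𝓐)
    (f : C(relNormOneIdeles X.K X.L ⧸ relNormOneRat X.K X.L, ℂ)) : weightForms (X.P k).ΓU B.kappa B.tau :=
  (X.P k).kernelDatum.thetaForm (probHaarRelNormOneQuot X.K X.L) (X.P k).kernelDatum_thetaLinear B.kappa (famTop k Φ)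
    (B.isThetaEquivariant_family hΦ) LinearMap.id B.tau_dual_apply f

/-- Defining property: `ℓ (θ g) = Θ̃_{Φ ℓ}(f)(g)`. -/
theorem apply_thetaFormOf {Φ : Module.Dual ℂ X.W →ₗ[ℂ] piSchwartzBruhat X.K X.J} (hΦ : Φ ∈ B.𝓐)
    (f : C(relNormOneIdeles X.K X.L ⧸ relNormOneRat X.K X.L, ℂ)) (g : X.GU) (ℓ : Module.Dual ℂ X.W) :
    ℓ ((B.thetaFormOf hΦ f : X.GU → X.W) g) =
      (X.P k).kernelDatum.thetaLiftFun (probHaarRelNormOneQuot X.K X.L) (famTop k Φ ℓ) f g :=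
  (X.P k).kernelDatum.apply_thetaForm _ _ _ _ _ _ _ f g ℓ

/-- The theta form of a family of `𝓐` lies in the situation's theta forms with weight functions `𝓕 ∋ f`. -/
theorem thetaFormOf_mem_thetaForms {Φ : Module.Dual ℂ X.W →ₗ[ℂ] piSchwartzBruhat X.K X.J} (hΦ : Φ ∈ B.𝓐)
    {𝓕 : Set C(relNormOneIdeles X.K X.L ⧸ relNormOneRat X.K X.L, ℂ)}
    {f : C(relNormOneIdeles X.K X.L ⧸ relNormOneRat X.K X.L, ℂ)} (hf : f ∈ 𝓕) :
    B.thetaFormOf hΦ f ∈ B.situation.thetaForms 𝓕 :=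
  (X.P k).kernelDatum.thetaForm_mem_thetaForms _ _ _ _ _ _ (B.mem_families hΦ) hf

/-- **The theta form of a family of `𝓐`, as a function on `G_U(𝔸)`, lies in the SATURATED adèlic theta module of the slot at `K_{Γ₀}`**
(#1238 `coe_mem_adelicThetaSpanSat`: the situation is strict and saturated). -/
theorem coe_thetaFormOf_mem_adelicThetaSpanSat {Φ : Module.Dual ℂ X.W →ₗ[ℂ] piSchwartzBruhat X.K X.J} (hΦ : Φ ∈ B.𝓐)
    {𝓕 : Set C(relNormOneIdeles X.K X.L ⧸ relNormOneRat X.K X.L, ℂ)}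
    {f : C(relNormOneIdeles X.K X.L ⧸ relNormOneRat X.K X.L, ℂ)} (hf : f ∈ 𝓕) :
    (B.thetaFormOf hΦ f : X.GU → X.W) ∈ adelicThetaSpanSat (X.P k) (X.ιinf B.Γ₀) X.κ₁ X.τ₁ (X.KΓ B.Γ₀) 𝓕 :=
  coe_mem_adelicThetaSpanSat B.situation B.situation_isSaturated B.situation_isStrict (B.thetaFormOf_mem_thetaForms hΦ hf)

/-- … and in the plain adèlic theta module. -/
theorem coe_thetaFormOf_mem_adelicThetaSpan {Φ : Module.Dual ℂ X.W →ₗ[ℂ] piSchwartzBruhat X.K X.J} (hΦ : Φ ∈ B.𝓐)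
    {𝓕 : Set C(relNormOneIdeles X.K X.L ⧸ relNormOneRat X.K X.L, ℂ)}
    {f : C(relNormOneIdeles X.K X.L ⧸ relNormOneRat X.K X.L, ℂ)} (hf : f ∈ 𝓕) :
    (B.thetaFormOf hΦ f : X.GU → X.W) ∈ adelicThetaSpan (X.P k) (X.ιinf B.Γ₀) X.κ₁ X.τ₁ 𝓕 :=
  adelicThetaSpanSat_le_adelicThetaSpan (B.coe_thetaFormOf_mem_adelicThetaSpanSat hΦ hf)

end ProductKTypeFamilies

end Model
end HodgeCM

end
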